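import Summits.CriticalPhenomena.PercolationContinuityZ3.Theorems.PercNearOneGluingNoHeavyLowerTailIncStarRootEdgeInduction
import HarnessLib

/-!
# The ROOT-STAR MIXTURE schema for the increasing star ("mixture over quotients", (MQ))

Support file for the Sahi programme (`--supports stmt-CriticalPhenomena-4575`, prover prim-sahi-p2 gen 16).  No definitions, no named
facts, no sorries; standard axioms.  Memo `run/shared/lean/prim/prim-sahi/FROM-prim-sahi-p2-gen16-CURVATURE-MAP-SHARP-FORM.md` §(D),
`prim-sahi-p2/PROOF-E3.md` §26h.

Let `T(w; s) = E₃({s↔b},{s↔c},{s↔y})` under `prodBernoulli w` (root `s`, targets `b, c, y`).  Condition on the states of the root pairs: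
with `F` the set of fractional non-loop pairs at `s` and, for `O ⊆ F`, `w^O` the weight that opens the pairs of `O` surely, closes those of
`F ∖ O` surely and agrees with `w` elsewhere, the law `prodBernoulli w` is the mixture `Σ_{O ⊆ F} π(O) · prodBernoulli w^O`,
`π(O) = Π_{e∈O} w e · Π_{e∈F∖O} (1 − w e)`, and `T(w^O; s)` is Sahi's cubic of the star of the QUOTIENT graph in which the root has been
glued to its `O`-neighbours (fewer vertices; in the fixed-type formalism: fewer fractional non-loop pairs).  Sahi's cubic is not affine in
the law, so `T(w; s)` and the mixture `Σ_O π(O) T(w^O; s)` differ; the conjecture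

  `(MQ)   T(w; s) ≥ Σ_{O ⊆ F} π(O) · T(w^O; s)`   ("sharing the whole root star among three copies never raises the kernel")

(prim-sahi-p2 gen 16: 0 violations in ≈ 23 000 adversarially climbed weighted graphs with ≤ 9 vertices, in 360 weightings of `K₆`/`K₇`, on the
bypass family `W2(k)` that refutes every single-pair chord/concavity relation — there with margin 13 % of `T` —, and coefficientwise in the root
weights on every support computed) would give the increasing star on every finite weighted graph by the one-line induction below.  By the law
of total cumulance `(MQ)` says that Sahi's cubic of the conditional connection probabilities `O ↦ P(O ↔ t in G − s)` on the cube `{0,1}^F`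
(a Sahi-on-the-cube term, `≥ 0` whenever Sahi's conjecture holds on that cube) always pays for the covariance term
`Σ_cyc Cov_π(P(O↔b), Cov(O↔c, O↔y))`, whose sign is indefinite.

**Theorem (`incStar_nonneg_of_rootStarMixture`).**  If `(MQ)` holds at every root with at least one fractional non-loop root pair — granted
the increasing star for every weight with fewer fractional non-loop pairs and every marking — then `E₃({s↔b},{s↔c},{s↔y}) ≥ 0` for every
weight on `Fin n` and all `s b c y`.  Proof: induction on the number of fractional non-loop pairs; re-root along weight-`1` pairs to a vertex
of the root's weight-`1` component carrying a fractional pair (`IncStar.sahiE3_hub_eq_of_sureReachable`), apply `(MQ)` there — every `w^O`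
has fewer fractional non-loop pairs, so the mixture is nonnegative by the induction hypothesis —, and when the weight-`1` component of the
root is closed the cluster of the root is a.s. deterministic and `E₃ = 0` (`IncStar.sahiE3_hub_eq_zero_of_closed`).  Nothing in this file
asserts `(MQ)`; it is the hypothesis.  The single-pair version of the hypothesis (condition on ONE root pair: the chord property) is false
(ttrl ISTAR.md, bypass family), and so is the same statement at a non-root vertex (gen 16); `(MQ)` is specific to the whole root star.
-/

noncomputable section

namespace Summit.CriticalPhenomena.PercolationContinuityZ3.Theorems

namespace IncStar

open Finset MeasureTheory Literature.Probability.Percolation Literature.Probability.LatticeModels EdgeInduction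
open scoped Classical

variable {n : ℕ}

/-- Pinning the pairs of `F` (to `1` on `O ⊆ F`, to `0` on `F ∖ O`) leaves outside `F` the weights of `w` and makes every pair of `F`
non-fractional: a fractional pair of the pinned weight is a fractional pair of `w` outside `F`. [folklore] -/
theorem mem_fracEdges_of_mem_fracEdges_pin (w : Sym2 (Fin n) → unitInterval) (F O : Finset (Sym2 (Fin n)))
    {f : Sym2 (Fin n)}
    (hf : f ∈ fracEdges (fun e => if e ∈ O then (1 : unitInterval) else if e ∈ F then 0 else w e)) :
    f ∉ F ∧ f ∈ fracEdges w := by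
  simp only [fracEdges, Finset.mem_filter, Finset.mem_univ, true_and] at hf ⊢
  by_cases hfO : f ∈ O
  · simp [hfO] at hf
  · by_cases hfF : f ∈ F
    · simp [hfO, hfF] at hf
    · simp only [hfO, hfF, if_false] at hf
      exact ⟨hfF, hf⟩

/-- Pinning a NONEMPTY set `F` of fractional non-loop pairs strictly decreases the number of fractional non-loop pairs. [folklore] -/
theorem card_fracEdges_pin_lt (w : Sym2 (Fin n) → unitInterval) {F : Finset (Sym2 (Fin n))} (O : Finset (Sym2 (Fin n)))
    (hF : F ⊆ (fracEdges w).filter fun e => ¬ e.IsDiag) (hne : F.Nonempty) :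
    ((fracEdges (fun e => if e ∈ O then (1 : unitInterval) else if e ∈ F then 0 else w e)).filter fun e => ¬ e.IsDiag).card <
      ((fracEdges w).filter fun e => ¬ e.IsDiag).card := by
  obtain ⟨e₀, he₀⟩ := hne
  have hsub : ((fracEdges (fun e => if e ∈ O then (1 : unitInterval) else if e ∈ F then 0 else w e)).filter fun e => ¬ e.IsDiag) ⊆
      ((fracEdges w).filter fun e => ¬ e.IsDiag).erase e₀ := by
    intro f hf
    rw [Finset.mem_filter] at hf
    obtain ⟨hfF, hfw⟩ := mem_fracEdges_of_mem_fracEdges_pin w F O hf.1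
    rw [Finset.mem_erase]
    exact ⟨fun h => hfF (h ▸ he₀), Finset.mem_filter.2 ⟨hfw, hf.2⟩⟩
  have h1 := Finset.card_le_card hsub
  rw [Finset.card_erase_of_mem (hF he₀)] at h1
  have hpos := Finset.card_pos.2 ⟨_, hF he₀⟩
  omega

/-- **ROOT-STAR MIXTURE SCHEMA ("mixture over quotients").**  Suppose that for every weight `w`, root `s` and targets `b c y` such that
`s` carries at least one fractional non-loop pair — and granted the increasing star for every weight with fewer fractional non-loop pairs
and every marking — Sahi's cubic dominates its root-star mixture:
`Σ_{O ⊆ F} (Π_{e∈O} w e)(Π_{e∈F∖O} (1 − w e)) · E₃(w^O) ≤ E₃(w)`, where `F` is the set of fractional non-loop pairs containing `s` and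
`w^O = (1 on O, 0 on F ∖ O, w elsewhere)`.  Then the increasing star `E₃({s↔b},{s↔c},{s↔y}) ≥ 0` holds for every weight on `Fin n`.
[this work] -/
theorem incStar_nonneg_of_rootStarMixture
    (h : ∀ (w : Sym2 (Fin n) → unitInterval) (s b c y : Fin n),
      ((fracEdges w).filter fun e => ¬ e.IsDiag ∧ s ∈ e).Nonempty →
      (∀ w' : Sym2 (Fin n) → unitInterval,
          ((fracEdges w').filter fun e => ¬ e.IsDiag).card < ((fracEdges w).filter fun e => ¬ e.IsDiag).card →
          ∀ s' b' c' y' : Fin n, 0 ≤ sahiE3 (prodBernoulli w') (openConn s' b') (openConn s' c') (openConn s' y')) →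
      ∑ O ∈ ((fracEdges w).filter fun e => ¬ e.IsDiag ∧ s ∈ e).powerset,
          (∏ e ∈ O, (w e : ℝ)) * (∏ e ∈ ((fracEdges w).filter fun e => ¬ e.IsDiag ∧ s ∈ e) \ O, (1 - (w e : ℝ))) *
            sahiE3 (prodBernoulli (fun e => if e ∈ O then (1 : unitInterval)
                else if e ∈ ((fracEdges w).filter fun e => ¬ e.IsDiag ∧ s ∈ e) then 0 else w e))
              (openConn s b) (openConn s c) (openConn s y) ≤
        sahiE3 (prodBernoulli w) (openConn s b) (openConn s c) (openConn s y)) :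
    ∀ (w : Sym2 (Fin n) → unitInterval) (s b c y : Fin n),
      0 ≤ sahiE3 (prodBernoulli w) (openConn s b) (openConn s c) (openConn s y) := by
  -- induction on the number of fractional NON-LOOP pairs
  suffices H : ∀ (k : ℕ) (w : Sym2 (Fin n) → unitInterval), ((fracEdges w).filter fun e => ¬ e.IsDiag).card ≤ k →
      ∀ s b c y : Fin n, 0 ≤ sahiE3 (prodBernoulli w) (openConn s b) (openConn s c) (openConn s y) from
    fun w s b c y => H _ w le_rfl s b c y
  intro k
  induction k with
  | zero =>
      intro w hk s b c y
      have hnone : ∀ z v : Fin n, z ≠ v → w s(z, v) = 0 ∨ w s(z, v) = 1 := by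
        intro z v hzv
        apply eq_zero_or_one_of_not_mem_fracEdges
        intro hmem
        have : s(z, v) ∈ (fracEdges w).filter fun e => ¬ e.IsDiag := by
          rw [Finset.mem_filter]; exact ⟨hmem, by rwa [Sym2.mk_isDiag_iff]⟩
        have := Finset.card_pos.2 ⟨_, this⟩
        omega
      refine le_of_eq (sahiE3_hub_eq_zero_of_closed w s ?_ b c y).symm
      intro z v hz hv hzv
      rcases hnone z v hzv with h0 | h1
      · exact h0
      · exact absurd (hz.trans (SimpleGraph.Adj.reachable (by
          rw [SimpleGraph.fromEdgeSet_adj]; exact ⟨h1, hzv⟩))) hv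
  | succ k ih =>
      intro w hk s b c y
      set G1 := SimpleGraph.fromEdgeSet {e : Sym2 (Fin n) | w e = 1} with hG1
      by_cases hfr : ∃ z v : Fin n, G1.Reachable s z ∧ z ≠ v ∧ s(z, v) ∈ fracEdges w
      · obtain ⟨z, v, hsz, hzv, he⟩ := hfr
        -- re-root at z, then apply the mixture hypothesis at the root z
        rw [sahiE3_hub_eq_of_sureReachable w hsz b c y]
        set F : Finset (Sym2 (Fin n)) := (fracEdges w).filter fun e => ¬ e.IsDiag ∧ z ∈ e with hFdef
        have hFsub : F ⊆ (fracEdges w).filter fun e => ¬ e.IsDiag := by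
          intro f hf
          rw [hFdef, Finset.mem_filter] at hf
          exact Finset.mem_filter.2 ⟨hf.1, hf.2.1⟩
        have hFne : F.Nonempty := by
          refine ⟨s(z, v), ?_⟩
          rw [hFdef, Finset.mem_filter]
          exact ⟨he, by rw [Sym2.mk_isDiag_iff]; exact hzv, Sym2.mem_mk_left z v⟩
        have IHpack : ∀ w' : Sym2 (Fin n) → unitInterval,
            ((fracEdges w').filter fun e => ¬ e.IsDiag).card < ((fracEdges w).filter fun e => ¬ e.IsDiag).card →
            ∀ s' b' c' y' : Fin n, 0 ≤ sahiE3 (prodBernoulli w') (openConn s' b') (openConn s' c') (openConn s' y') :=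
          fun w' hw' s' b' c' y' => ih w' (by omega) s' b' c' y'
        have hmix := h w z b c y hFne IHpack
        refine le_trans ?_ hmix
        refine Finset.sum_nonneg fun O hO => ?_
        have hlt := card_fracEdges_pin_lt w O hFsub hFne
        have i0 := ih (fun e => if e ∈ O then (1 : unitInterval) else if e ∈ F then 0 else w e) (by omega) z b c y
        have hp1 : 0 ≤ ∏ e ∈ O, (w e : ℝ) := Finset.prod_nonneg fun e _ => (w e).2.1
        have hp2 : 0 ≤ ∏ e ∈ F \ O, (1 - (w e : ℝ)) := Finset.prod_nonneg fun e _ => sub_nonneg.2 (w e).2.2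
        exact mul_nonneg (mul_nonneg hp1 hp2) i0
      · -- no fractional pair touches the weight-1 component of s: it is closed
        push Not at hfr
        refine le_of_eq (sahiE3_hub_eq_zero_of_closed w s ?_ b c y).symm
        intro z v hz hv hzv
        rcases eq_zero_or_one_of_not_mem_fracEdges (hfr z v hz hzv) with h0 | h1
        · exact h0
        · exact absurd (hz.trans (SimpleGraph.Adj.reachable (by
            rw [SimpleGraph.fromEdgeSet_adj]; exact ⟨h1, hzv⟩))) hv

/-! ## Addendum (prim-sahi-p2 gen 18, 2026-08-23): STATUS OF THE HYPOTHESIS — `(MQ)` IS FALSE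

The universal hypothesis `hMQ` of `incStar_nonneg_of_rootStarMixture` (the conjecture `(MQ)` of the header: 'sharing the whole root star among
three copies never raises the kernel', reported above with '0 violations in ≈ 23 000 weighted graphs') was REFUTED exactly in prim-sahi-p2 gen 17
and census §62 (same hour, independently): witness A (6 vertices, exact rationals): root `s = 0`, targets `1, 2, 3`, further vertices `o = 4`, `x = 5`; pair weights
`(s,o) = 1 − 10⁻¹¹`, `(s,2) = 1/2`, `(1,2) = 1/2`, `(o,2) = 1619/1620`, `(2,3) = 3/4`, `(o,x) = 1/4`, `(x,2) = 3/4`, `(x,3) = 1/4` (all other pairs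
weight `0`).  There the root-star mixture slack is
`Φ = T(w; s) − Σ_O π(O) T(w^O; s) = −2233727963462351710991103745506326371 / 563585608581120000000000000000000000000000000000 ≈ −3.96·10⁻¹²`
(`T(w; s) ≈ 9.90·10⁻⁵ > 0`; with `(s,o) = 1` exactly, `Φ = −1681/281792804290560`).  Confirmed digit for digit by six independent exact engines
(prim-sahi-p2 gen 17 `gen17/py/witness_exact.py`; census §62 + addenda: `bern3.py`, `comb/w73/mqn.py`, `comb/w70/mq.py`; lead gen 117 `mqn_graph.py`;
referee R613 `ref613_mq.py`).  MECHANISM (memo FROM-prim-sahi-p2-gen17-MQ-REFUTED-HITTING-C3.md §1.2, `prim-sahi-p2/PROOF-E3.md` §27a–c): give the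
root one near-sure pair `(s,r)` and move a sub-star `P` of `r` to `s`; as `w(s,r) → 1` the `(MQ)` instance at `s` degenerates to 'revealing only the
sub-star `P` at `r`', and for `|P| = 1` this is the single-root-pair chord inequality, refuted on the bypass family `W2` (ttrl) — witness B =
`W2(3)` hub–target with `p(r,h) = 9/10` plus the new root: `Φ = −6.666·10⁻¹³` exactly.  Census §62 gives the closed form
`Φ(ε,p) = λ·ε(1−ε)(1−p)²(1−τ)·[L + (1−τ)·ΔP_c·(1−p)(1+ε)]` with the x-hub defect `L = −41/65536`, and witnesses with all weights in `{1/4, 1/2, 3/4}`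
(two-path bundles, 35 vertices).  The defect is tiny (`|Φ|/T ≤ 10⁻⁷`) but its support is an open set of ordinary sparse weighted graphs, so no
weight-bounded / simple-graph / distinct-target restriction of the hypothesis survives.

CONSEQUENCES.  `incStar_nonneg_of_rootStarMixture` remains a correct theorem (a conditional schema) whose hypothesis is not a theorem; as a route
to `stmt-CriticalPhenomena-4575` it is CLOSED.  What stays useful from this file: the pinning lemmas (`mem_fracEdges_of_mem_fracEdges_pin`, the
re-rooting along weight-one pairs) and the law-of-total-probability bookkeeping reused by `…IncStarRootStarTwoStep` (`real_eq_sum_rootStarMixture`)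
and `…IncStarDualRevelation`.  With `(MQ)` fell, on the same witness: `(S1-term)` (`−9.93·10⁻¹²`), `(MQ-Bern)` (`B₁^Φ(o,2) = −2.09·10⁻⁵`, see the
addendum of `…IncStarSlackEdgeInduction`) and the root-profile coefficientwise form (tensor-Bernstein coefficient `(3,2)` in `(w_so, w_s2)` equal to
`−1681/105672301608960`).  UNTOUCHED on both witnesses (exact): the increasing star itself, single-pair Bernstein positivity `B₁, B₂ ≥ 0` along all 15
pairs, ISTARK, mean-chord, three-copy fibre positivity.  The mirror statement `(D′)` (reveal all NON-root pairs; `…IncStarDualRevelation`) is standing.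
-/

end IncStar

end Summit.CriticalPhenomena.PercolationContinuityZ3.Theorems
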